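import Summits.QuantumFields.YangMills.Theorems.ColdStartUniversalityLatticeLangevinCorrectorIncrements
import Summits.QuantumFields.YangMills.Theorems.ColdStartUniversalityLatticeLangevinMartingaleMaximal
import Summits.QuantumFields.YangMills.Theorems.ColdStartUniversalityLatticeLangevinPoissonEquation
import HarnessLib

/-!
# Route `ColdStartUniversality` (fixed-cut-off SZZ dynamics): ★★★ SUB-GAUSSIAN EXPONENTIAL MOMENTS OF ADDITIVE FUNCTIONALS OF THE
# COLD-START SAMPLER — `E exp(λ ∫₀ᵀ (G(U_r) − μ_(β')G) dr) ≤ exp(b|λ| + 9 b λ² (T + b))`, `b = 4C/c`, every real `λ`, every start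

Helper file (seat `ym-line-csu-p1`, g34; `--supports stmt-QuantumFields-24809`).  The Laplace-transform form behind the Hoeffding bounds of
files 70/82: with the corrector increments of file 81 (`Σ_(k<N) D_k = u(U_T) − u(x) + ∫₀ᵀ Ĝ(U_r) dr`, `|u| ≤ β_u`, `|D_k| ≤ 2β_u + 2h`, orthogonal to
the past) and the sub-Gaussian moment generating function of file 78 (`E e^(λ S_N) ≤ e^(Nλ²B²/2)`), on the grid `h = T/⌈T/b⌉`, `b = 2β_u`,
`N B² ≤ 9b(T+b)`:
* ★★ `integral_exp_mul_timeIntegral_le_of_corrector_of_prog` / `…_of_corrector` — generic: `E exp(λ∫_(0,T] Ĝ(U_r)dr) ≤ exp(b|λ| + 9bλ²(T+b))`,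
  `b = 2β_u`, for every (progressively measurable / arbitrary) strong solution from a deterministic start on ANY space, all real `λ`, all `T > 0`;
* ★★★ `integral_exp_mul_timeIntegral_le` — with g16's corrector (`b = 4C/c`): **`E exp(λ ∫_(0,T] (G(U_r) − μ_(β')G) dr) ≤ exp(b|λ| + 9bλ²(T+b))`
  for EVERY strong solution of the SU(2) SZZ dynamics from a deterministic start, every continuous `|G| ≤ 1`, every coupling** — the scaled
  cumulant generating function of the additive functional is at most quadratic: `limsup_T T⁻¹ log E e^(λ∫₀ᵀĜ) ≤ 9bλ²` (Gaussian large-deviation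
  upper bound at fixed cut-off), and all moments follow (`E(∫₀ᵀĜ)^(2k) = O_k((b(T+b))^k)`).
THEOREMS ONLY, no definition, no sorry; [folklore].  HONEST FRAMING: fixed cut-off; `C, c` depend on `L, β'`; `UniformColdStartMixing` (24809) is
NOT restated; no crux, rung or summit statement is proved; the Yang–Mills mass gap is NOT proved.
-/

set_option autoImplicit false

noncomputable section

namespace Summit.QuantumFields.YangMills.Theorems.ColdStartUniversality

open MeasureTheory ProbabilityTheory Filter Topology Set
open scoped NNReal ENNReal BigOperators
open Literature Literature.Probability.Process Literature.MathematicalPhysics.QuantumFieldTheory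
open Literature.MathematicalPhysics.QuantumLattice (fundamentalRep fundamentalLatticeRep continuous_fundamentalRep)

variable {L : ℕ} [NeZero L]

/-- ★★ **Sub-Gaussian exponential moments of the additive functional from a bounded corrector (progressively measurable solutions).**  With
`b = 2β_u`: `E exp(λ ∫_(0,T] (G(U_r) − μ_(β')G) dr) ≤ exp(b|λ| + 9 b λ² (T + b))` for every real `λ` and `T > 0`. [folklore] -/
theorem integral_exp_mul_timeIntegral_le_of_corrector_of_prog (β' : ℝ)
    (κ : ℝ≥0 → Kernel (GaugeConfig 3 L (Matrix.specialUnitaryGroup (Fin 2) ℂ))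
      (GaugeConfig 3 L (Matrix.specialUnitaryGroup (Fin 2) ℂ))) [∀ t, IsMarkovKernel (κ t)]
    (hreal : ∀ (t : ℝ≥0) (x : GaugeConfig 3 L (Matrix.specialUnitaryGroup (Fin 2) ℂ))
        (Ω : Type) [MeasurableSpace Ω] (P : Measure Ω) [IsProbabilityMeasure P]
        (W : ℝ≥0 → Ω → (Edge 3 L × NoiseIdx 2 → ℝ)) (hW : IsFlatBrownian W P)
        (U : ℝ≥0 → Ω → GaugeConfig 3 L (Matrix.specialUnitaryGroup (Fin 2) ℂ)),
        (∀ ω, U 0 ω = x) →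
        (latticeLangevinDynamics (fundamentalLatticeRep 2) β').IsSolution (fundamentalRep (Fin 2))
          hW.natFiltration P W U →
        κ t x = P.map (U t))
    {G : GaugeConfig 3 L (Matrix.specialUnitaryGroup (Fin 2) ℂ) → ℝ} (hG : Continuous G) (hG1 : ∀ z, |G z| ≤ 1)
    {u : GaugeConfig 3 L (Matrix.specialUnitaryGroup (Fin 2) ℂ) → ℝ} (hum : Measurable u) {βu : ℝ} (hβu : 0 < βu) (hu_b : ∀ y, |u y| ≤ βu)
    (hPois : ∀ (s : ℝ≥0) (y : GaugeConfig 3 L (Matrix.specialUnitaryGroup (Fin 2) ℂ)),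
      (∫ z, u z ∂(κ s y)) - u y = -∫ t in (0 : ℝ)..(s : ℝ),
        (∫ z, (G z - ∫ z', G z' ∂(wilsonMeasure (d := 3) (L := L) (fundamentalRep (Fin 2)) β')) ∂(κ t.toNNReal y)))
    (x : GaugeConfig 3 L (Matrix.specialUnitaryGroup (Fin 2) ℂ))
    {Ω : Type} [MeasurableSpace Ω] {P : Measure Ω} [IsProbabilityMeasure P]
    {W : ℝ≥0 → Ω → (Edge 3 L × NoiseIdx 2 → ℝ)} (hW : IsFlatBrownian W P)
    {U : ℝ≥0 → Ω → GaugeConfig 3 L (Matrix.specialUnitaryGroup (Fin 2) ℂ)} (hU0 : ∀ ω, U 0 ω = x)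
    (hU : (latticeLangevinDynamics (fundamentalLatticeRep 2) β').IsSolution (fundamentalRep (Fin 2)) hW.natFiltration P W U)
    (hprog : ∀ i : ℝ≥0, Measurable[@Prod.instMeasurableSpace (Set.Iic i) Ω inferInstance (hW.natFiltration i)]
      (fun q : Set.Iic i × Ω => U q.1 q.2))
    {T : ℝ} (hT : 0 < T) (l : ℝ) :
    ∫ ω, Real.exp (l * ∫ r in Ioc (0 : ℝ) T,
        (G (U r.toNNReal ω) - ∫ z', G z' ∂(wilsonMeasure (d := 3) (L := L) (fundamentalRep (Fin 2)) β'))) ∂P ≤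
      Real.exp (2 * βu * |l| + 9 * (2 * βu) * l ^ 2 * (T + 2 * βu)) := by
  classical
  haveI := secondCountableTopology_su2
  haveI := borelSpace_config L
  set m : ℝ := ∫ z', G z' ∂(wilsonMeasure (d := 3) (L := L) (fundamentalRep (Fin 2)) β') with hm
  -- the grid
  set b : ℝ := 2 * βu with hb
  have hb0 : 0 < b := by positivity
  set N : ℕ := ⌈T / b⌉₊ with hN
  have hTb : 0 < T / b := div_pos hT hb0
  have hN0 : 0 < N := Nat.ceil_pos.2 hTb
  have hNr : (0 : ℝ) < N := by exact_mod_cast hN0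
  have hNge : T / b ≤ N := Nat.le_ceil _
  have hNlt : (N : ℝ) < T / b + 1 := Nat.ceil_lt_add_one hTb.le
  set h : ℝ := T / N with hh
  have hh0 : 0 < h := div_pos hT hNr
  have hhb : h ≤ b := by
    rw [hh, div_le_iff₀ hNr]
    calc T = T / b * b := by field_simp
      _ ≤ N * b := by gcongr
      _ = b * N := mul_comm _ _
  have hNh : (N : ℝ) * h = T := by rw [hh]; field_simp
  obtain ⟨D, hDF, hDb, horth, hsum⟩ := exists_correctorIncrements β' κ hreal hG hG1 hum hu_b hPois x hW hU0 hU hprog hh0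
  set B : ℝ := 2 * βu + 2 * h with hB
  have hB0 : 0 < B := by positivity
  have hℱmono : Monotone fun k : ℕ => hW.natFiltration ((k : ℝ) * h).toNNReal := fun j k hjk =>
    hW.natFiltration.mono (Real.toNNReal_le_toNNReal (mul_le_mul_of_nonneg_right (by exact_mod_cast hjk) hh0.le))
  -- sub-Gaussian MGF of `S_N` (file 78)
  have hmgf := integral_exp_mul_sum_le_of_orthogonal_past (fun k : ℕ => hW.natFiltration ((k : ℝ) * h).toNNReal)
    (fun k => hW.natFiltration.le _) hℱmono D hDF hB0 hDb N (fun k _ => horth k) l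
  -- `∫₀ᵀ Ĝ = S_N − u(U_T) + u(x)`
  have hI : ∀ ω, (∫ r in Ioc (0 : ℝ) T, (G (U r.toNNReal ω) - m)) =
      (∑ k ∈ Finset.range N, D k ω) - u (U (((N : ℝ) * h).toNNReal) ω) + u x := fun ω => by
    rw [hsum N ω, hNh]; ring
  -- pointwise: `exp(λ ∫Ĝ) ≤ e^(b|λ|) · exp(λ S_N)`
  have hDm : ∀ k, Measurable (D k) := fun k => (hDF k).mono (hW.natFiltration.le _) le_rfl
  have hSm : Measurable fun ω => ∑ k ∈ Finset.range N, D k ω := Finset.measurable_sum _ fun k _ => hDm k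
  have hSb : ∀ ω, |∑ k ∈ Finset.range N, D k ω| ≤ N * B := fun ω =>
    (Finset.abs_sum_le_sum_abs _ _).trans (by
      calc ∑ k ∈ Finset.range N, |D k ω| ≤ ∑ _k ∈ Finset.range N, B := Finset.sum_le_sum fun k _ => hDb k ω
        _ = N * B := by rw [Finset.sum_const, Finset.card_range, nsmul_eq_mul])
  have hexpSi : Integrable (fun ω => Real.exp (l * ∑ k ∈ Finset.range N, D k ω)) P := by
    refine (integrable_const (Real.exp (|l| * (N * B)))).mono' (hSm.const_mul l).exp.aestronglyMeasurable (Eventually.of_forall fun ω => ?_)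
    rw [Real.norm_eq_abs, abs_of_pos (Real.exp_pos _), Real.exp_le_exp]
    calc l * ∑ k ∈ Finset.range N, D k ω ≤ |l * ∑ k ∈ Finset.range N, D k ω| := le_abs_self _
      _ = |l| * |∑ k ∈ Finset.range N, D k ω| := abs_mul _ _
      _ ≤ |l| * (N * B) := mul_le_mul_of_nonneg_left (hSb ω) (abs_nonneg l)
  have hpt : ∀ ω, Real.exp (l * ∫ r in Ioc (0 : ℝ) T, (G (U r.toNNReal ω) - m)) ≤
      Real.exp (b * |l|) * Real.exp (l * ∑ k ∈ Finset.range N, D k ω) := fun ω => by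
    rw [hI ω, ← Real.exp_add, Real.exp_le_exp]
    have h1 : l * (-u (U (((N : ℝ) * h).toNNReal) ω) + u x) ≤ b * |l| := by
      have h2 : |-u (U (((N : ℝ) * h).toNNReal) ω) + u x| ≤ b := by
        rw [hb]
        calc |-u (U (((N : ℝ) * h).toNNReal) ω) + u x| ≤ |-u (U (((N : ℝ) * h).toNNReal) ω)| + |u x| := abs_add_le _ _
          _ ≤ βu + βu := add_le_add (by rw [abs_neg]; exact hu_b _) (hu_b _)
          _ = 2 * βu := by ring
      calc l * (-u (U (((N : ℝ) * h).toNNReal) ω) + u x) ≤ |l * (-u (U (((N : ℝ) * h).toNNReal) ω) + u x)| := le_abs_self _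
        _ = |l| * |-u (U (((N : ℝ) * h).toNNReal) ω) + u x| := abs_mul _ _
        _ ≤ |l| * b := mul_le_mul_of_nonneg_left h2 (abs_nonneg l)
        _ = b * |l| := mul_comm _ _
    nlinarith
  -- `N B² ≤ 9 b (T + b)`
  have hNb : (N : ℝ) * b ≤ T + b := by
    have h1 := mul_lt_mul_of_pos_right hNlt hb0
    rw [add_mul, div_mul_cancel₀ _ hb0.ne', one_mul] at h1
    exact h1.le
  have hB3 : B ≤ 3 * b := by rw [hB, hb]; linarith
  have hNB : (N : ℝ) * B ^ 2 ≤ 9 * b * (T + b) := by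
    calc (N : ℝ) * B ^ 2 ≤ N * (3 * b) ^ 2 := by gcongr
      _ = 9 * b * (N * b) := by ring
      _ ≤ 9 * b * (T + b) := by gcongr
  calc ∫ ω, Real.exp (l * ∫ r in Ioc (0 : ℝ) T, (G (U r.toNNReal ω) - m)) ∂P
      ≤ ∫ ω, Real.exp (b * |l|) * Real.exp (l * ∑ k ∈ Finset.range N, D k ω) ∂P := by
        refine integral_mono_of_nonneg (ae_of_all _ fun ω => (Real.exp_pos _).le) (hexpSi.const_mul _) (ae_of_all _ hpt)
    _ = Real.exp (b * |l|) * ∫ ω, Real.exp (l * ∑ k ∈ Finset.range N, D k ω) ∂P := integral_const_mul _ _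
    _ ≤ Real.exp (b * |l|) * Real.exp (N * (l ^ 2 * B ^ 2 / 2)) := mul_le_mul_of_nonneg_left hmgf (Real.exp_pos _).le
    _ ≤ Real.exp (2 * βu * |l| + 9 * (2 * βu) * l ^ 2 * (T + 2 * βu)) := by
        rw [← Real.exp_add, Real.exp_le_exp, ← hb]
        have h1 : (N : ℝ) * (l ^ 2 * B ^ 2 / 2) ≤ 9 * b * l ^ 2 * (T + b) := by
          have h2 : (N : ℝ) * (l ^ 2 * B ^ 2 / 2) = l ^ 2 / 2 * (N * B ^ 2) := by ring
          rw [h2]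
          nlinarith [sq_nonneg l, mul_nonneg (mul_nonneg (by norm_num : (0 : ℝ) ≤ 9) hb0.le) (add_pos hT hb0).le]
        linarith

/-- ★★ **Sub-Gaussian exponential moments of the additive functional from a bounded corrector (EVERY strong solution).** [folklore] -/
theorem integral_exp_mul_timeIntegral_le_of_corrector (β' : ℝ)
    (κ : ℝ≥0 → Kernel (GaugeConfig 3 L (Matrix.specialUnitaryGroup (Fin 2) ℂ))
      (GaugeConfig 3 L (Matrix.specialUnitaryGroup (Fin 2) ℂ))) [∀ t, IsMarkovKernel (κ t)]
    (hreal : ∀ (t : ℝ≥0) (x : GaugeConfig 3 L (Matrix.specialUnitaryGroup (Fin 2) ℂ))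
        (Ω : Type) [MeasurableSpace Ω] (P : Measure Ω) [IsProbabilityMeasure P]
        (W : ℝ≥0 → Ω → (Edge 3 L × NoiseIdx 2 → ℝ)) (hW : IsFlatBrownian W P)
        (U : ℝ≥0 → Ω → GaugeConfig 3 L (Matrix.specialUnitaryGroup (Fin 2) ℂ)),
        (∀ ω, U 0 ω = x) →
        (latticeLangevinDynamics (fundamentalLatticeRep 2) β').IsSolution (fundamentalRep (Fin 2))
          hW.natFiltration P W U →
        κ t x = P.map (U t))
    {G : GaugeConfig 3 L (Matrix.specialUnitaryGroup (Fin 2) ℂ) → ℝ} (hG : Continuous G) (hG1 : ∀ z, |G z| ≤ 1)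
    {u : GaugeConfig 3 L (Matrix.specialUnitaryGroup (Fin 2) ℂ) → ℝ} (hum : Measurable u) {βu : ℝ} (hβu : 0 < βu) (hu_b : ∀ y, |u y| ≤ βu)
    (hPois : ∀ (s : ℝ≥0) (y : GaugeConfig 3 L (Matrix.specialUnitaryGroup (Fin 2) ℂ)),
      (∫ z, u z ∂(κ s y)) - u y = -∫ t in (0 : ℝ)..(s : ℝ),
        (∫ z, (G z - ∫ z', G z' ∂(wilsonMeasure (d := 3) (L := L) (fundamentalRep (Fin 2)) β')) ∂(κ t.toNNReal y)))
    (x : GaugeConfig 3 L (Matrix.specialUnitaryGroup (Fin 2) ℂ))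
    {Ω : Type} [MeasurableSpace Ω] {P : Measure Ω} [IsProbabilityMeasure P]
    {W : ℝ≥0 → Ω → (Edge 3 L × NoiseIdx 2 → ℝ)} (hW : IsFlatBrownian W P)
    {U : ℝ≥0 → Ω → GaugeConfig 3 L (Matrix.specialUnitaryGroup (Fin 2) ℂ)} (hU0 : ∀ ω, U 0 ω = x)
    (hU : (latticeLangevinDynamics (fundamentalLatticeRep 2) β').IsSolution (fundamentalRep (Fin 2)) hW.natFiltration P W U)
    {T : ℝ} (hT : 0 < T) (l : ℝ) :
    ∫ ω, Real.exp (l * ∫ r in Ioc (0 : ℝ) T,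
        (G (U r.toNNReal ω) - ∫ z', G z' ∂(wilsonMeasure (d := 3) (L := L) (fundamentalRep (Fin 2)) β'))) ∂P ≤
      Real.exp (2 * βu * |l| + 9 * (2 * βu) * l ^ 2 * (T + 2 * βu)) := by
  classical
  obtain ⟨V, -, hV, hVprog, -, -, -⟩ := exists_regularFlow L β' hW
  have hprog : ∀ i : ℝ≥0, Measurable[@Prod.instMeasurableSpace (Set.Iic i) Ω inferInstance (hW.natFiltration i)]
      (fun q : Set.Iic i × Ω => V x q.1 q.2) := fun i =>
    (hVprog i).comp (measurable_fst.prodMk (measurable_const.prodMk measurable_snd))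
  have hmain := integral_exp_mul_timeIntegral_le_of_corrector_of_prog β' κ hreal hG hG1 hum hβu hu_b hPois x hW (hV x).1 (hV x).2 hprog hT l
  have hae := latticeLangevin_pathwise_unique hW β' x hU0 (hV x).1 hU (hV x).2
  have hfun : (fun ω => Real.exp (l * ∫ r in Ioc (0 : ℝ) T,
        (G (U r.toNNReal ω) - ∫ z', G z' ∂(wilsonMeasure (d := 3) (L := L) (fundamentalRep (Fin 2)) β')))) =ᵐ[P]
      fun ω => Real.exp (l * ∫ r in Ioc (0 : ℝ) T,
        (G (V x r.toNNReal ω) - ∫ z', G z' ∂(wilsonMeasure (d := 3) (L := L) (fundamentalRep (Fin 2)) β'))) := by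
    filter_upwards [hae] with ω hω
    have h1 : (fun r : ℝ => G (U r.toNNReal ω) - ∫ z', G z' ∂(wilsonMeasure (d := 3) (L := L) (fundamentalRep (Fin 2)) β')) =
        fun r : ℝ => G (V x r.toNNReal ω) - ∫ z', G z' ∂(wilsonMeasure (d := 3) (L := L) (fundamentalRep (Fin 2)) β') :=
      funext fun r => by rw [hω]
    rw [h1]
  rw [integral_congr_ae hfun]
  exact hmain

/-- ★★★ **SUB-GAUSSIAN EXPONENTIAL MOMENTS OF ADDITIVE FUNCTIONALS OF THE COLD-START SAMPLER** (every coupling, every start, every realisation;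
`C, c` depend on `L, β'`): there are `C, c > 0` such that, with `b = 4C/c`, for EVERY strong solution `U` of the SU(2) SZZ dynamics from a
deterministic start on ANY probability space, every continuous `G` with `|G| ≤ 1`, every `T > 0` and every real `λ`:
`E exp(λ ∫_(0,T] (G(U_r) − μ_(β')G) dr) ≤ exp(b|λ| + 9 b λ² (T + b))`. [folklore] -/
theorem integral_exp_mul_timeIntegral_le (L : ℕ) [NeZero L] (β' : ℝ) :
    ∃ C c : ℝ, 0 < C ∧ 0 < c ∧
      ∀ (x : GaugeConfig 3 L (Matrix.specialUnitaryGroup (Fin 2) ℂ))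
        (Ω : Type) [MeasurableSpace Ω] (P : Measure Ω) [IsProbabilityMeasure P]
        (W : ℝ≥0 → Ω → (Edge 3 L × NoiseIdx 2 → ℝ)) (hW : IsFlatBrownian W P)
        (U : ℝ≥0 → Ω → GaugeConfig 3 L (Matrix.specialUnitaryGroup (Fin 2) ℂ)),
        (∀ ω, U 0 ω = x) →
        (latticeLangevinDynamics (fundamentalLatticeRep 2) β').IsSolution (fundamentalRep (Fin 2)) hW.natFiltration P W U →
        ∀ (G : GaugeConfig 3 L (Matrix.specialUnitaryGroup (Fin 2) ℂ) → ℝ), Continuous G → (∀ z, |G z| ≤ 1) →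
        ∀ (T : ℝ), 0 < T → ∀ (l : ℝ),
          ∫ ω, Real.exp (l * ∫ r in Ioc (0 : ℝ) T,
              (G (U r.toNNReal ω) - ∫ z', G z' ∂(wilsonMeasure (d := 3) (L := L) (fundamentalRep (Fin 2)) β'))) ∂P ≤
            Real.exp (4 * C / c * |l| + 9 * (4 * C / c) * l ^ 2 * (T + 4 * C / c)) := by
  classical
  haveI := secondCountableTopology_su2
  haveI := borelSpace_config L
  haveI : IsProbabilityMeasure (wilsonMeasure (d := 3) (L := L) (fundamentalRep (Fin 2)) β') :=
    isProbabilityMeasure_wilsonMeasure (d := 3) (L := L) (fundamentalRep (Fin 2)) (continuous_fundamentalRep (Fin 2)) β'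
  obtain ⟨C, c, hC, hc, hP⟩ := exists_poisson_solution L β'
  refine ⟨C, c, hC, hc, fun x Ω _ P _ W hW U hU0 hU G hG hG1 T hT l => ?_⟩
  obtain ⟨κ, hκM, -, hreal⟩ := exists_transitionKernel L β'
  haveI := hκM
  set m : ℝ := ∫ z', G z' ∂(wilsonMeasure (d := 3) (L := L) (fundamentalRep (Fin 2)) β') with hm
  have hm1 : |m| ≤ 1 := by
    have hh := norm_integral_le_of_norm_le_const (μ := wilsonMeasure (d := 3) (L := L) (fundamentalRep (Fin 2)) β') (f := G) (C := 1)
      (Eventually.of_forall fun z => by simpa [Real.norm_eq_abs] using hG1 z)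
    simpa [Real.norm_eq_abs] using hh
  have hGhc : Continuous fun z => G z - m := hG.sub continuous_const
  have hGhb : ∀ z, |G z - m| ≤ 2 := fun z => (abs_sub _ _).trans (by linarith [hG1 z, hm1])
  have hGh0 : ∫ z, (G z - m) ∂(wilsonMeasure (d := 3) (L := L) (fundamentalRep (Fin 2)) β') = 0 := by
    have hGi : Integrable G (wilsonMeasure (d := 3) (L := L) (fundamentalRep (Fin 2)) β') :=
      (integrable_const (1 : ℝ)).mono' hG.measurable.aestronglyMeasurable (Eventually.of_forall fun z => by simpa [Real.norm_eq_abs] using hG1 z)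
    rw [integral_sub hGi (integrable_const m), integral_const, smul_eq_mul, probReal_univ, one_mul, hm, sub_self]
  obtain ⟨u, hu_c, -, hu_b, -, hPois⟩ := hP κ hreal (fun z => G z - m) hGhc hGh0 2 hGhb
  have hβu : (0 : ℝ) < 2 * C / c := by positivity
  have hmain := integral_exp_mul_timeIntegral_le_of_corrector β' κ hreal hG hG1 hu_c.measurable hβu hu_b hPois x hW hU0 hU hT l
  refine hmain.trans (le_of_eq ?_)
  congr 1
  ring

end Summit.QuantumFields.YangMills.Theorems.ColdStartUniversality

end
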